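import Summits.AtomisticToContinuum.Crystallization.Theorems.PhononSlackCertificatesCoerciveTwoShellGapPeriodisation
import Summits.AtomisticToContinuum.Crystallization.Theorems.ReggeStarCoercivityDefectFreeCrystallizesSqueezeToLayeredA
import Summits.AtomisticToContinuum.Crystallization.Theorems.ReggeStarCoercivityZeroDefectDensityTwoShell

/-!
# Crux `NashTwoShellGap` (stmt-AtomisticToContinuum-16826), line `bulk_dilute`:
# the Nash-free bulk (bad-phase) gap alone makes the bad fraction of ground states vanish

Kernel-checked bookkeeping for the lead's registered sub-goal `stub_badFractionOfBadPhaseGap`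
(line `bulk_dilute`).  Hypothesis (the bulk stub `stub_badPhaseGap` as a statement): for every
density `β₀ > 0` there is a flat gap `γ > 0` such that every periodic configuration `P` of `ℝ³`
with `1/3`-separated point set and at least `β₀ · #motif` motif points that are `1/20`-bad in
`P.points` has `e* + γ ≤ e(P)` (`e* = ⨅_Q e(Q)`).  Conclusion: along every sequence `x N` of
Lennard-Jones ground states the fraction `#{i : ¬ IsTwoShellGood (1/20) (47/50) 1 (x N) i} / N`
tends to `0` — which is everything the route's assembly extracts from the crux.

PROOF.  The fraction is non-negative, so it suffices to show it is eventually `< ε` for every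
`ε > 0`.  Take `γ = γ(ε)` from the hypothesis.  By the `o(N)` energy budget of ground states
(`PrestressSplitKorn.squeeze_tendsto_excess_div`), eventually `(𝓔(x N) − N e*)/N < γ` and `N ≥ 1`.
For such `N`, if `#bad(x N) ≥ ε N`, periodise `x N` (`CoarseTierTransfer.exists_periodicConfiguration`:
motif `univ.image (x N)`, long periods): the periodisation `P` has `1/3`-separated points
(`separated_points` and `ZeroDefectDensity.third_le_dist_of_isGroundState`), `#motif = N`, at least
`#bad(x N) ≥ ε · #motif` bad motif points (`CoerciveTwoShellGapPeriodisation.card_bad_le`) and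
`e(P) ≤ 𝓔(x N)/N` (`energyPerParticle_le`); the hypothesis gives `e* + γ ≤ e(P) ≤ 𝓔(x N)/N`,
contradicting `(𝓔(x N) − N e*)/N < γ`.  No definitions; `[folklore]`.
-/

noncomputable section

namespace Summit.AtomisticToContinuum.Crystallization.Theorems.NashTwoShellGapBadFractionOfBadPhaseGap

open scoped BigOperators Classical
open Filter Topology
open Literature.MathematicalPhysics.StatisticalMechanics Literature.Geometry.DiscreteGeometry
open Summit.AtomisticToContinuum.Crystallization.Theorems

/-- **Registered sub-goal `stub_badFractionOfBadPhaseGap`** (lead, line `bulk_dilute`): the Nash-free flat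
bad-phase gap on periodic configurations (`stub_badPhaseGap` as a hypothesis) alone implies that along every
sequence of Lennard-Jones ground states the fraction of `1/20`-bad (non-two-shell-good) particles tends to `0`:
if `#bad(x N) ≥ ε N` for a large `N`, the periodisation of `x N` has `1/3`-separated points, bad motif fraction
`≥ ε` and energy per particle `≤ 𝓔(x N)/N < e* + γ(ε)` (the `o(N)` budget `squeeze_tendsto_excess_div`),
against `e* + γ(ε) ≤ e(P)` from the hypothesis. [folklore] -/
theorem stub_badFractionOfBadPhaseGap : (∀ β₀ : ℝ, 0 < β₀ → ∃ γ : ℝ, 0 < γ ∧ ∀ P : Literature.MathematicalPhysics.StatisticalMechanics.PeriodicConfiguration 3, (∀ u ∈ P.points, ∀ v ∈ P.points, u ≠ v → (1 / 3 : ℝ) ≤ dist u v) → β₀ * (P.motif.card : ℝ) ≤ ((P.motif.filter fun y => ¬ Literature.Geometry.DiscreteGeometry.IsTwoShellGoodSet (1 / 20) (47 / 50) 1 P.points y).card : ℝ) → (⨅ Q : Literature.MathematicalPhysics.StatisticalMechanics.PeriodicConfiguration 3, Q.energyPerParticle Literature.MathematicalPhysics.StatisticalMechanics.lennardJones) + γ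 ≤ P.energyPerParticle Literature.MathematicalPhysics.StatisticalMechanics.lennardJones) → ∀ x : (N : ℕ) → (Fin N → EuclideanSpace ℝ (Fin 3)), (∀ N, Literature.MathematicalPhysics.StatisticalMechanics.IsGroundState Literature.MathematicalPhysics.StatisticalMechanics.lennardJones (x N)) → Filter.Tendsto (fun N : ℕ => (Nat.card {i : Fin N // ¬ Literature.Geometry.DiscreteGeometry.IsTwoShellGood (1 / 20) (47 / 50) 1 (x N) i} : ℝ) / N) Filter.atTop (nhds 0) := by
  intro hB x hx
  -- the `o(N)` energy budget of ground states: `(𝓔(x N) - N e*)/N → 0`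
  have hlim := PrestressSplitKorn.squeeze_tendsto_excess_div x hx
  -- the bad fraction is non-negative, so only the upper estimate is needed
  refine tendsto_order.2 ⟨fun a ha => Eventually.of_forall fun N => ha.trans_le (by positivity),
    fun ε hε => ?_⟩
  obtain ⟨γ, hγ, hBγ⟩ := hB ε hε
  filter_upwards [hlim.eventually_lt_const hγ, eventually_gt_atTop 0] with N hNγ hN0
  have hNr : (0 : ℝ) < N := by exact_mod_cast hN0
  rw [div_lt_iff₀ hNr]
  by_contra hge
  push Not at hge
  -- periodise `x N`
  have hxi : Function.Injective (x N) := (hx N).1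
  obtain ⟨P, hPm, hPl⟩ := CoarseTierTransfer.exists_periodicConfiguration (x N) hN0
  have hsep : ∀ i j : Fin N, i ≠ j → (1 / 3 : ℝ) ≤ dist (x N i) (x N j) := fun i j hij =>
    ZeroDefectDensity.third_le_dist_of_isGroundState (hx N) hij
  have hsepP := CoarseTierTransfer.separated_points hPm hPl hsep
  have hcardm : (P.motif.card : ℝ) = N := by
    rw [hPm, Finset.card_image_of_injective _ hxi]
    simp
  have hcnt : (Nat.card {i : Fin N // ¬ IsTwoShellGood (1 / 20) (47 / 50) 1 (x N) i} : ℝ) ≤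
      ((P.motif.filter fun y => ¬ IsTwoShellGoodSet (1 / 20) (47 / 50) 1 P.points y).card : ℝ) := by
    exact_mod_cast CoerciveTwoShellGapPeriodisation.card_bad_le hPm hPl hxi
  have hfrac : ε * (P.motif.card : ℝ) ≤
      ((P.motif.filter fun y => ¬ IsTwoShellGoodSet (1 / 20) (47 / 50) 1 P.points y).card : ℝ) := by
    rw [hcardm]
    exact hge.trans hcnt
  -- the bulk gap on the torus against the budget
  have key := hBγ P hsepP hfrac
  have hle := CoarseTierTransfer.energyPerParticle_le hPm hPl hxi hN0
  have h4 : (⨅ Q : PeriodicConfiguration 3, Q.energyPerParticle lennardJones) + γ ≤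
      interactionEnergy lennardJones (x N) / N := key.trans hle
  rw [le_div_iff₀ hNr] at h4
  rw [div_lt_iff₀ hNr] at hNγ
  linarith

end Summit.AtomisticToContinuum.Crystallization.Theorems.NashTwoShellGapBadFractionOfBadPhaseGap

end
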